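import Literature.NumberTheory.LFunctions.RiemannSiegelChiStirling
import Literature.NumberTheory.LFunctions.RiemannSiegelChiBounds
import Literature.Analysis.SpecialFunctions.DigammaStirlingSecondOrder
import HarnessLib

/-!
# Stirling's formula for the logarithmic derivative of `χ(s)`: `χ′/χ(s) = −log(t/2π) + O(1/t)`

Topic `Literature/NumberTheory/LFunctions` (companion of `RiemannSiegelChiStirling.lean`, which
proves Stirling's formula for `χ` itself, Titchmarsh (4.12.3)). Everything here is PROVED; no
definitions beyond abbreviations, no named facts.

For the factor `χ(s) = (2π)^s/(2Γ(s)cos(πs/2))` of the functional equation `ζ(s) = χ(s)ζ(1−s)`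
(the tree's `Literature.NumberTheory.LFunctions.SiegelIntegral.rsChi`, Titchmarsh (2.1.10)), the
logarithmic derivative satisfies, for `s = σ + it` in any fixed strip and `t → ∞`,

  `χ′(s)/χ(s) = −log(t/2π) + O(1/t)`.

This is the logarithmic derivative of the functional equation (Montgomery–Vaughan (10.35):
"`L′/L(s,χ) = −L′/L(1−s,χ̄) − log(q/2π) − Γ′/Γ(1−s) + (π/2)cot(π(s+κ)/2)`", here `q = 1`, `κ = 0`,
rewritten at `s` instead of `1−s`) combined with Stirling's formula for `Γ′/Γ` (Montgomery–Vaughan,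
Theorem C.1 (C.17): "`Γ′/Γ(s) = log s + O(1/|s|)`", and the sharper display
"`Γ′/Γ(s) = log s − 1/(2s) + O(|s|⁻²)`" in its proof) — the input by which `ζ′` is traded for `−(log t/2π)ζ` under the functional equation
in every Levinson-type mean-value computation (Levinson 1974 §2, Conrey; cf. the docstrings of
`Conrey1989MeanValue.lean` and `LevinsonMethodMollifier.lean`, which quote it unproved), and the
"Stirling formula" step of Y. Zhang, arXiv:2211.02515 (2022), Lemma 5.1 / (4.6)
("`Z′/Z(s+w′,ψ) = −log p + ϑ′/ϑ(s+w′) + O(ε) = −log(pt/2π) + O(1/t₀)`"; Zhang's `ϑ` is `χ`).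

* `ChiLogDeriv.logDeriv_rsChi_eq` — the exact formula
  `χ′/χ(s) = log 2π − ψ(s) + (π/2)tan(πs/2)` off the poles (`ψ = Γ′/Γ`, Mathlib's `digamma`);
* `ChiLogDeriv.tan_eq` — `tan(πs/2) = i(1 − q)/(1 + q)`, `q = e^{iπs}`, `|q| = e^{−πt}`;
* **`norm_logDeriv_rsChi_add_log_le`** — for `1 ≤ A`, `0 < σ ≤ A`, `t ≥ 2A`:
  `‖χ′/χ(σ+it) + log(t/2π)‖ ≤ (2A + 3)/t`.

Proof: `ψ(s) = Log s − 1/(2s) + O(1/t²)` (the tree's complex second-order Stirling bound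
`Literature.Analysis.SpecialFunctions.Complex.norm_digamma_sub_log_add_inv_le`),
`Log(σ+it) = log t + iπ/2 + Log(1 − iσ/t)` (`ChiStirling.log_ofReal_add_mul_I`) with
`‖Log(1 − iσ/t)‖ ≤ (3/2)σ/t`, and `(π/2)tan(πs/2) = iπ/2 − iπq/(1+q)` with `|q| = e^{−πt} ≤ 1/(πt)`;
the two `iπ/2` cancel.

## References

* H. L. Montgomery, R. C. Vaughan, *Multiplicative Number Theory I* (CUP 2007), Ch. 10 (10.35)
  (logarithmic derivative of the functional equation), Appendix C, Theorem C.1 (C.17) and the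
  display `Γ′/Γ(s) = log s − 1/(2s) + O(|s|⁻²)` in its proof. [cite: MontgomeryVaughan2007, Ch. 10 (10.35); App. C Thm C.1 (C.17)]
* E. C. Titchmarsh, *The Theory of the Riemann Zeta-Function*, 2nd ed. (OUP 1986), §2.1 (2.1.10)
  (`χ(s)`), §4.12 (Stirling for `χ`). [cite: Titchmarsh1986, §2.1 (2.1.10)]
* N. Levinson, *More than one third of zeros of Riemann's zeta-function are on σ = 1/2*,
  Adv. Math. 13 (1974), 383–436, §2. [cite: Levinson1974, §2]
-/

noncomputable section

open Complex Real Set Filter Topology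

namespace Literature.NumberTheory.LFunctions

open SiegelIntegral
open Literature.Analysis.SpecialFunctions.Complex (norm_digamma_sub_log_add_inv_le)

/-! ### The exact formula for `χ′/χ` -/

/-- **`χ′/χ(s) = log 2π − ψ(s) + (π/2) tan(πs/2)`** (`ψ = Γ′/Γ`), from
`χ(s) = (2π)^s/(2Γ(s)cos(πs/2))`, off the poles of `Γ` and the zeros of `cos(πs/2)` (Montgomery–Vaughan
(10.35) at `q = 1`, `κ = 0`, written at `s`). [cite: MontgomeryVaughan2007, Ch. 10 (10.35)] -/
theorem ChiLogDeriv.logDeriv_rsChi_eq {s : ℂ} (hΓ : ∀ m : ℕ, s ≠ -(m : ℂ))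
    (hcos : Complex.cos (π * s / 2) ≠ 0) :
    logDeriv rsChi s = Real.log (2 * π) - digamma s
      + π / 2 * (Complex.sin (π * s / 2) / Complex.cos (π * s / 2)) := by
  have hπ : (π : ℂ) ≠ 0 := ofReal_ne_zero.mpr Real.pi_ne_zero
  have h2π : (2 * π : ℂ) ≠ 0 := mul_ne_zero two_ne_zero hπ
  have hΓne : Gamma s ≠ 0 := Complex.Gamma_ne_zero hΓ
  have hfd : HasDerivAt (fun z : ℂ => (2 * π : ℂ) ^ z) ((2 * π : ℂ) ^ s * Complex.log (2 * π)) s :=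
    (hasStrictDerivAt_const_cpow (Or.inl h2π)).hasDerivAt
  have hΓd : DifferentiableAt ℂ Complex.Gamma s := Complex.differentiableAt_Gamma _ hΓ
  have hcosd' : HasDerivAt (fun z : ℂ => Complex.cos (π * z / 2))
      (-Complex.sin (π * s / 2) * (π / 2)) s := by
    have h1 : HasDerivAt (fun z : ℂ => π * z / 2) (π / 2) s := by
      simpa using ((hasDerivAt_id s).const_mul (π : ℂ)).div_const 2
    exact (Complex.hasDerivAt_cos (π * s / 2)).comp s h1
  have hcosd : DifferentiableAt ℂ (fun z : ℂ => Complex.cos (π * z / 2)) s := hcosd'.differentiableAt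
  have hg1d : DifferentiableAt ℂ (fun z : ℂ => 2 * Complex.Gamma z) s :=
    (differentiableAt_const _).mul hΓd
  have hgd : DifferentiableAt ℂ (fun z : ℂ => 2 * Complex.Gamma z * Complex.cos (π * z / 2)) s :=
    hg1d.mul hcosd
  have hgne : 2 * Complex.Gamma s * Complex.cos (π * s / 2) ≠ 0 :=
    mul_ne_zero (mul_ne_zero two_ne_zero hΓne) hcos
  have hfne : (2 * π : ℂ) ^ s ≠ 0 := by
    rw [Ne, cpow_eq_zero_iff, not_and_or]
    exact Or.inl h2π
  have e0 : rsChi = fun z => (fun z : ℂ => (2 * π : ℂ) ^ z) z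
      / (fun z : ℂ => 2 * Complex.Gamma z * Complex.cos (π * z / 2)) z := by
    funext z
    rw [rsChi_def]
  rw [e0, logDeriv_div s hfne hgne hfd.differentiableAt hgd]
  have e1 : logDeriv (fun z : ℂ => (2 * π : ℂ) ^ z) s = Real.log (2 * π) := by
    rw [logDeriv_apply, hfd.deriv, show (2 : ℂ) * π = ((2 * π : ℝ) : ℂ) by push_cast; ring,
      ← Complex.ofReal_log (by positivity)]
    field_simp
  have e2 : logDeriv (fun z : ℂ => 2 * Complex.Gamma z * Complex.cos (π * z / 2)) s
      = digamma s + -(π / 2) * (Complex.sin (π * s / 2) / Complex.cos (π * s / 2)) := by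
    rw [logDeriv_mul (f := fun z : ℂ => 2 * Complex.Gamma z) (g := fun z : ℂ => Complex.cos (π * z / 2))
      s (mul_ne_zero two_ne_zero hΓne) hcos hg1d hcosd,
      logDeriv_const_mul s 2 two_ne_zero, Complex.digamma_def]
    congr 1
    rw [logDeriv_apply, hcosd'.deriv]
    field_simp
  rw [e1, e2]
  ring

/-! ### `tan(πs/2) = i + O(e^{−πt})` -/

/-- `tan(πs/2)·(1 + q) = i(1 − q)` with `q = e^{iπs}`, division-free. [folklore] -/
theorem ChiLogDeriv.sin_mul_eq (s : ℂ) :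
    Complex.sin (π * s / 2) * (1 + cexp (π * s * I))
      = I * Complex.cos (π * s / 2) * (1 - cexp (π * s * I)) := by
  set E : ℂ := cexp (π * s / 2 * I) with hE
  have hF : cexp (-(π * s / 2) * I) = E⁻¹ := by rw [neg_mul, Complex.exp_neg]
  have hq : cexp (π * s * I) = E ^ 2 := by
    rw [hE, sq, ← Complex.exp_add]
    congr 1
    ring
  have hEF : E * E⁻¹ = 1 := mul_inv_cancel₀ (Complex.exp_ne_zero _)
  rw [Complex.cos, Complex.sin, hF, hq]
  linear_combination (I * E) * hEF

/-- **`tan(πs/2) = i(1 − q)/(1 + q)`**, `q = e^{iπs}` (`|q| = e^{−πt}`), off the zeros of `cos(πs/2)`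
and for `1 + q ≠ 0`. [folklore] -/
theorem ChiLogDeriv.tan_eq {s : ℂ} (hcos : Complex.cos (π * s / 2) ≠ 0)
    (hq : 1 + cexp (π * s * I) ≠ 0) :
    Complex.sin (π * s / 2) / Complex.cos (π * s / 2)
      = I * (1 - cexp (π * s * I)) / (1 + cexp (π * s * I)) := by
  rw [div_eq_div_iff hcos hq]
  linear_combination ChiLogDeriv.sin_mul_eq s

/-- `‖e^{iπs}‖ = e^{−πt}`. [folklore] -/
theorem ChiLogDeriv.norm_cexp_pi_mul_I (s : ℂ) : ‖cexp (π * s * I)‖ = Real.exp (-(π * s.im)) := by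
  have h := ChiStirling.norm_cexp_pi_mul_mul_I s.re s.im
  rwa [re_add_im] at h

/-! ### The estimate -/

/-- **Stirling for `χ′/χ`** (Montgomery–Vaughan (10.35) with (C.17); Levinson 1974 §2): for
`1 ≤ A`, `0 < σ ≤ A` and `t ≥ 2A`, `‖χ′/χ(σ+it) + log(t/2π)‖ ≤ (2A + 3)/t`.
[cite: MontgomeryVaughan2007, Ch. 10 (10.35); App. C Thm C.1 (C.17)] -/
theorem norm_logDeriv_rsChi_add_log_le {A σ t : ℝ} (hA : 1 ≤ A) (hσ0 : 0 < σ) (hσA : σ ≤ A)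
    (ht : 2 * A ≤ t) :
    ‖logDeriv rsChi (σ + t * I) + Real.log (t / (2 * π))‖ ≤ (2 * A + 3) / t := by
  have ht1 : 2 ≤ t := by linarith
  have ht0 : 0 < t := by linarith
  set s : ℂ := σ + t * I with hs
  have hsre : s.re = σ := by simp [hs]
  have hsim : s.im = t := by simp [hs]
  have him_ne : s.im ≠ 0 := by rw [hsim]; exact ht0.ne'
  -- the exact formula
  have hcos : Complex.cos (π * s / 2) ≠ 0 := cos_pi_mul_div_two_ne_zero_of_im_ne_zero him_ne
  have hΓ : ∀ m : ℕ, s ≠ -(m : ℂ) := by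
    intro m h
    have := congrArg Complex.im h
    simp at this
    exact him_ne this
  rw [ChiLogDeriv.logDeriv_rsChi_eq hΓ hcos]
  -- (1) Stirling for ψ: ψ(s) = Log s − 1/(2s) + E₁
  set E₁ : ℂ := digamma s - Complex.log s + 1 / (2 * s) with hE₁def
  have hE₁ : ‖E₁‖ ≤ 1 / (2 * t) := by
    have h := norm_digamma_sub_log_add_inv_le (w := s) (by rw [hsre]; exact hσ0)
      (by rw [hsim]; exact ht0)
    rw [hsim, abs_of_pos ht0] at h
    refine h.trans ?_
    -- 2(1/(6t³) + π/(12t²)) ≤ 1/(2t) for t ≥ 2 (uses π ≤ 4)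
    have ht2 : 4 ≤ t ^ 2 := by nlinarith
    have h1 : 1 / (6 * t ^ 3) ≤ 1 / (24 * t) :=
      one_div_le_one_div_of_le (by positivity) (by nlinarith)
    have h2 : π / (12 * t ^ 2) ≤ 1 / (6 * t) := by
      rw [div_le_div_iff₀ (by positivity) (by positivity)]
      nlinarith [Real.pi_le_four]
    have h3 : 2 * (1 / (24 * t) + 1 / (6 * t)) ≤ 1 / (2 * t) := by
      rw [show 2 * (1 / (24 * t) + 1 / (6 * t)) = 5 / (12 * t) by field_simp; ring,
        div_le_div_iff₀ (by positivity) (by positivity)]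
      nlinarith
    linarith
  -- (2) Log s = log t + iπ/2 + E₂
  set E₂ : ℂ := Complex.log (1 + -((σ : ℂ) / t) * I) with hE₂def
  have hlog : Complex.log s = Real.log t + π / 2 * I + E₂ :=
    ChiStirling.log_ofReal_add_mul_I ht0 (by rw [abs_of_pos hσ0]; linarith)
  have hE₂ : ‖E₂‖ ≤ 3 / 2 * (σ / t) := by
    have hz : ‖-((σ : ℂ) / t) * I‖ ≤ 1 / 2 := by
      rw [norm_mul, Complex.norm_I, mul_one, norm_neg, norm_div, Complex.norm_real,
        Complex.norm_real, Real.norm_eq_abs, Real.norm_eq_abs, abs_of_pos hσ0, abs_of_pos ht0,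
        div_le_iff₀ ht0]
      linarith
    have h := Complex.norm_log_one_add_half_le_self hz
    rw [norm_mul, Complex.norm_I, mul_one, norm_neg, norm_div, Complex.norm_real,
      Complex.norm_real, Real.norm_eq_abs, Real.norm_eq_abs, abs_of_pos hσ0, abs_of_pos ht0] at h
    exact h
  -- (3) 1/(2s)
  have hE₃ : ‖1 / (2 * s)‖ ≤ 1 / (2 * t) := by
    rw [norm_div, norm_one, norm_mul, Complex.norm_two]
    have : t ≤ ‖s‖ := by
      have := Complex.abs_im_le_norm s
      rw [hsim, abs_of_pos ht0] at this
      exact this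
    exact one_div_le_one_div_of_le (by positivity) (by nlinarith)
  -- (4) (π/2) tan(πs/2) = iπ/2 − iπ q/(1+q)
  set q : ℂ := cexp (π * s * I) with hq
  have hqn : ‖q‖ = Real.exp (-(π * t)) := by rw [hq, ChiLogDeriv.norm_cexp_pi_mul_I, hsim]
  have hq_small : ‖q‖ ≤ 1 / (π * t) := by rw [hqn]; exact ChiStirling.exp_neg_pi_mul_le ht0
  have hq_half : ‖q‖ ≤ 1 / 2 := by
    refine hq_small.trans ?_
    rw [div_le_div_iff₀ (by positivity) (by norm_num)]
    nlinarith [Real.pi_gt_three]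
  have h1q : 1 / 2 ≤ ‖1 + q‖ := by
    have := norm_sub_norm_le (1 : ℂ) (-q)
    rw [norm_one, norm_neg, sub_neg_eq_add] at this
    linarith
  have h1q0 : 1 + q ≠ 0 := by
    intro h; rw [h, norm_zero] at h1q; linarith
  have htan : (π : ℂ) / 2 * (Complex.sin (π * s / 2) / Complex.cos (π * s / 2))
      = π / 2 * I - π * I * q / (1 + q) := by
    rw [ChiLogDeriv.tan_eq hcos h1q0, ← hq]
    field_simp
    ring
  have hE₄ : ‖(π : ℂ) * I * q / (1 + q)‖ ≤ 2 / t := by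
    rw [norm_div, norm_mul, norm_mul, Complex.norm_I, mul_one, Complex.norm_real, Real.norm_eq_abs,
      abs_of_pos Real.pi_pos, div_le_iff₀ (by linarith)]
    calc π * ‖q‖ ≤ π * (1 / (π * t)) := by gcongr
      _ = 1 / t := by field_simp
      _ = 2 / t * (1 / 2) := by ring
      _ ≤ 2 / t * ‖1 + q‖ := by gcongr
  -- assemble: the main terms cancel
  have key : (Real.log (2 * π) : ℂ) - digamma s
        + (π : ℂ) / 2 * (Complex.sin (π * s / 2) / Complex.cos (π * s / 2))
        + (Real.log (t / (2 * π)) : ℂ)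
      = -E₂ + 1 / (2 * s) - E₁ - π * I * q / (1 + q) := by
    rw [htan, Real.log_div ht0.ne' (by positivity)]
    have : digamma s = Complex.log s - 1 / (2 * s) + E₁ := by rw [hE₁def]; ring
    rw [this, hlog]
    push_cast
    ring
  rw [key]
  calc ‖-E₂ + 1 / (2 * s) - E₁ - π * I * q / (1 + q)‖
      ≤ ‖E₂‖ + ‖1 / (2 * s)‖ + ‖E₁‖ + ‖(π : ℂ) * I * q / (1 + q)‖ := by
        have h1 := norm_sub_le (-E₂ + 1 / (2 * s) - E₁) (π * I * q / (1 + q))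
        have h2 := norm_sub_le (-E₂ + 1 / (2 * s)) E₁
        have h3 := norm_add_le (-E₂) (1 / (2 * s))
        rw [norm_neg] at h3
        linarith
    _ ≤ 3 / 2 * (σ / t) + 1 / (2 * t) + 1 / (2 * t) + 2 / t := by gcongr
    _ ≤ (2 * A + 3) / t := by
        rw [show 3 / 2 * (σ / t) + 1 / (2 * t) + 1 / (2 * t) + 2 / t = (3 / 2 * σ + 3) / t by
          field_simp; ring]
        gcongr
        linarith

end Literature.NumberTheory.LFunctions
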